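import Summits.BirchSwinnertonDyer.BirchSwinnertonDyer.Theses.UniversalToricDescent
import Summits.BirchSwinnertonDyer.BirchSwinnertonDyer.Theorems.UniversalToricDescentAcDualMuZeroCriterion
import Summits.BirchSwinnertonDyer.BirchSwinnertonDyer.Theorems.UniversalToricDescentStrictPlaceNoPTorsion
import Literature.NumberTheory.EllipticCurves.Castella2024.LambdaAdicHeegnerClassExistence
import Literature.NumberTheory.EllipticCurves.HeegnerModuleIndex
import Literature.NumberTheory.EllipticCurves.IwasawaSelmer
import Mathlib.RingTheory.Jacobson.Ideal
import Mathlib.NumberTheory.Padics.PadicIntegers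

/-!
# Sketch (bsd-wall-utd-idea g62) — the EISENSTEIN-PRIME ROAD for `K2_res` of line `beta-road` v5 on crux 24737
# `TwinAlgMuZeroAtThree` (lens: transfer-with-dictionary, cell x9's typed Howard engine ↦ bucket B at `3 ∥ N′`).

Contents (all `sorry`-free; the three `Prop`s are CANDIDATE statements, the theorems are proved):
* §1 `K1`, `K2Res` = the statements of the registered stubs `stub_coherentBetaMult`, `stub_residualCorankLeOneMult`
  of `beta-road` v5 (LEAD utd-p1 g23, sha16 0e83e6faf0d76c96) VERBATIM; **`K2ResOfBeta`** = the proposed RESHAPE of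
  K2_res (the residual corank-one bound CONDITIONAL on the K1 witness at the degree-one primes above 3), and the
  two-line composition `k2Res_of_k1_of_k2ResOfBeta : K1 → K2ResOfBeta → K2Res` (so replacing the stub by the reshaped
  one keeps `TwinAlgMuZeroAtThree_of` intact).
* §2 the local algebra of Howard's control lemma (arXiv:1202.6340 Lemma 3.2.7 ≈ p.16–17) at a MULTIPLICATIVE place
  above 3 along the Eisenstein height-one primes `𝔮_m = ((γ-1)^m + 3)`: on B⁻ (nonsplit) the graded piece
  `(T/Fil) ⊗ S_𝔮(Ψ_𝔮)` has NO invariants for ANY twist congruent to 1 (`smul_fixed_eq_zero_of_isUnit_one_add` +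
  `isUnit_one_add_of_sub_one_mem_jacobson`) — error-free control; term (ii) (`H²(K_v, Fil 𝐓)[q_m]`) vanishes for both
  signs by `mem_span_singleton_of_prime_mul_mem` (`q_m` prime, `q_m ∤ ω_s`); on B⁺ (split) the invariants have `ℤ₃`-length exactly
  `3^s` for `m ≥ 3^s` (`EisensteinSplitControlBound`, candidate, checked numerically for `s ≤ 2`, `m ≤ 14`; its `s = 0` case
  `eisensteinSplitControlBound_rung_zero` is PROVED), and in representation language `twistedLine_invariants_eq_zero` (B⁻).
-/

noncomputable section
open scoped Classical
set_option linter.dupNamespace false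
set_option autoImplicit false

namespace Summit.BirchSwinnertonDyer.BirchSwinnertonDyer.Cruxes.TwinAlgMuZeroAtThree.EisensteinRoad
open NumberField IsDedekindDomain Field WeierstrassCurve
open Literature.NumberTheory.EllipticCurves Literature.NumberTheory.EllipticCurves.GreenbergSelmer
open Summit.BirchSwinnertonDyer.Rank1Residual.X11b Summit.BirchSwinnertonDyer.Rank1Residual.X11b.AcSelmer
open Summit.BirchSwinnertonDyer.BirchSwinnertonDyer.Theorems.UniversalToricDescentAcDualMuZero

/-! ## §1 The reshape `K2_res ∣ β` -/

/-- **K1** — statement of `stub_coherentBetaMult` (beta-road v5) verbatim. -/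
def K1 : Prop :=
    ∀ (W' : WeierstrassCurve ℚ) [W'.IsElliptic] [W'.IsGloballyMinimal] (N' : ℕ) [NeZero N']
      (K : Type) [Field K] [NumberField K],
      Rank1Residual.Mult W' 3 → ¬ 3 ∣ padicValInt 3 W'.minimalDiscriminantInt →
      W'.HasSurjectiveModNGaloisRep 3 → W'.conductorNorm ℤ = N' → IsImaginaryQuadratic K →
      SatisfiesHeegnerHypothesis N' K → Odd (NumberField.discr K) →
      ∀ (κ : ZpExtension K 3), κ.IsAnticyclotomic →
      ∀ (γ : absoluteGaloisGroup K) [Fact (κ.IsTopGenerator γ)]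
        (𝔭 : HeightOneSpectrum (𝓞 K)), ((3 : ℕ) : 𝓞 K) ∈ 𝔭.asIdeal →
        𝔭.asIdeal.ramificationIdx (𝓞 ℚ) = 1 → 𝔭.asIdeal.inertiaDeg (𝓞 ℚ) = 1 →
      ∃ (jbar : AlgebraicClosure K →+* ℂ) (F : HeegnerFamily N' W' K κ jbar) (α : ℤ),
        ¬ (3 : ℤ) ∣ F.Dt.c ∧ α ^ 2 = 1 ∧ F.IsNormCompatible γ α ∧
        (∃ k : ℕ, ∀ (Q : geomPoints (W'.baseChange K))
          (hQ : ∀ σ ∈ κ.layerSubgroup k ⊓ decomp 𝔭, σ • ((3 : ℤ) • Q) = (3 : ℤ) • Q),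
          (3 : ℤ) • Q = F.z k →
            (W'.baseChange K).kummerClassOver (κ.layerSubgroup k ⊓ decomp 𝔭) 3 Q hQ ≠ 0)

/-- **K2Res** — statement of `stub_residualCorankLeOneMult` (beta-road v5) verbatim: the residual corank-one bound
`#Sel_{3^∞}(E′/K_∞)[3]^{γ^{3ⁿ}} ≤ 3^{3ⁿ+C}`, i.e. `rank_Λ X + #{μ_i ≥ 1} ≤ 1`, on bucket B, UNCONDITIONALLY. -/
def K2Res : Prop :=
    ∀ (W' : WeierstrassCurve ℚ) [W'.IsElliptic] [W'.IsGloballyMinimal] (N' : ℕ) [NeZero N']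
      (K : Type) [Field K] [NumberField K],
      Rank1Residual.Mult W' 3 → ¬ 3 ∣ padicValInt 3 W'.minimalDiscriminantInt →
      W'.HasSurjectiveModNGaloisRep 3 → W'.conductorNorm ℤ = N' → IsImaginaryQuadratic K →
      SatisfiesHeegnerHypothesis N' K → Odd (NumberField.discr K) →
      ∀ (κ : ZpExtension K 3), κ.IsAnticyclotomic →
      ∀ (γ : absoluteGaloisGroup K) [Fact (κ.IsTopGenerator γ)],
      ∃ C : ℕ, ∀ n : ℕ,
        Nat.card {s : (W'.baseChange K).selmerInfty κ |
          3 • s = 0 ∧ (W'.baseChange K).conjH1 3 κ.kerSubgroup (γ ^ 3 ^ n)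
            (s : (W'.baseChange K).subgroupH1 3 κ.kerSubgroup) = s} ≤ 3 ^ (3 ^ n + C)

/-- **K2ResOfBeta** (CANDIDATE reshaped stub `K2_res ∣ β`): the residual corank-one bound for `Sel_{3^∞}(E′/K_∞)` on
bucket B, CONDITIONAL on the K1 data — at every degree-one prime `𝔭 ∋ 3` of `K` a norm-coherent Heegner family with
Manin constant prime to 3 one of whose layer points is locally 3-indivisible at `𝔭`.  This is the statement the
Eisenstein-prime road proves as a PORT: K1-witness ⇒ `loc_𝔭 κ₁ ∉ 3·H¹(K_𝔭, Fil 𝐓)` ⇒ `κ₁ ∉ 3𝔖**` (so `κ₁ ≠ 0` and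
`μ(𝔖/Λκ₁) = 0`) ⇒ Howard 2004 Thm. 2.2.10 (a)(b) over the Greenberg/Tate-line Selmer structure and (c) AT `𝔓 = 3Λ` via the
Eisenstein primes `𝔮_m = ((γ-1)^m + 3)` (arXiv:1202.6340 p.18 L16–43, «taking `𝔮 = T^m + p`») ⇒ `X ∼ Λ ⊕ M ⊕ M`, `μ(M) = 0`
⇒ the bound with `C` from `λ(M)` and the finite pseudo-isomorphism defects.  The hypothesis is K1's conclusion VERBATIM,
universally over `𝔭`, so `K1 → K2ResOfBeta → K2Res` is two lines (`k2Res_of_k1_of_k2ResOfBeta`). -/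
def K2ResOfBeta : Prop :=
    ∀ (W' : WeierstrassCurve ℚ) [W'.IsElliptic] [W'.IsGloballyMinimal] (N' : ℕ) [NeZero N']
      (K : Type) [Field K] [NumberField K],
      Rank1Residual.Mult W' 3 → ¬ 3 ∣ padicValInt 3 W'.minimalDiscriminantInt →
      W'.HasSurjectiveModNGaloisRep 3 → W'.conductorNorm ℤ = N' → IsImaginaryQuadratic K →
      SatisfiesHeegnerHypothesis N' K → Odd (NumberField.discr K) →
      ∀ (κ : ZpExtension K 3), κ.IsAnticyclotomic →
      ∀ (γ : absoluteGaloisGroup K) [Fact (κ.IsTopGenerator γ)],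
      (∀ (𝔭 : HeightOneSpectrum (𝓞 K)), ((3 : ℕ) : 𝓞 K) ∈ 𝔭.asIdeal →
        𝔭.asIdeal.ramificationIdx (𝓞 ℚ) = 1 → 𝔭.asIdeal.inertiaDeg (𝓞 ℚ) = 1 →
        ∃ (jbar : AlgebraicClosure K →+* ℂ) (F : HeegnerFamily N' W' K κ jbar) (α : ℤ),
          ¬ (3 : ℤ) ∣ F.Dt.c ∧ α ^ 2 = 1 ∧ F.IsNormCompatible γ α ∧
          (∃ k : ℕ, ∀ (Q : geomPoints (W'.baseChange K))
            (hQ : ∀ σ ∈ κ.layerSubgroup k ⊓ decomp 𝔭, σ • ((3 : ℤ) • Q) = (3 : ℤ) • Q),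
            (3 : ℤ) • Q = F.z k →
              (W'.baseChange K).kummerClassOver (κ.layerSubgroup k ⊓ decomp 𝔭) 3 Q hQ ≠ 0)) →
      ∃ C : ℕ, ∀ n : ℕ,
        Nat.card {s : (W'.baseChange K).selmerInfty κ |
          3 • s = 0 ∧ (W'.baseChange K).conjH1 3 κ.kerSubgroup (γ ^ 3 ^ n)
            (s : (W'.baseChange K).subgroupH1 3 κ.kerSubgroup) = s} ≤ 3 ^ (3 ^ n + C)

/-- The reshape is conservative: the registered stub K2_res follows from K1 (already a stub of the line) and the
reshaped, port-sized `K2ResOfBeta`. -/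
theorem k2Res_of_k1_of_k2ResOfBeta (h1 : K1) (h2 : K2ResOfBeta) : K2Res := by
  intro W' _ _ N' _ K _ _ hM hv hs hN hIQ hH hodd κ hκ γ _
  exact h2 W' N' K hM hv hs hN hIQ hH hodd κ hκ γ
    (fun 𝔭 h3 he hf => h1 W' N' K hM hv hs hN hIQ hH hodd κ hκ γ 𝔭 h3 he hf)

/-! ## §2 Local algebra of the control lemma along `𝔮_m` at a multiplicative place above 3

Dictionary (Howard p.16 L150 – p.17 L36): the kernel/cokernel of `H¹_Gr(K_v, 𝐓)/𝔮 → H¹_Gr(K_v, T_𝔮)` and of its discrete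
twin are governed by `H⁰(K_v, gr_v A_𝔮)` with `gr_v = T/Fil_v`.  For the Tate curve `E′/ℚ₃` the torus line `Fil_v = ℤ₃(1)`
has graded piece `ℤ₃(η)`, `η` the unramified character with `η(Frob) = -1` (nonsplit, B⁻) or `η = 1` (split, B⁺); over
`K_v` twisted by the Eisenstein specialisation `Ψ_𝔮 : Γ → S_𝔮^×`, `S_𝔮 = ℤ₃[π]/(π^m + 3)`, `Ψ_𝔮(γ) = 1 + π` — a character
with `Ψ_𝔮 ≡ 1 (mod π)` — Frobenius acts on the graded line by `η(Frob)·ψ` with `ψ - 1 ∈ 𝔪`.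
-/

/-- **B⁻ is error-free.** If Frobenius acts on the graded line by `-ψ` with `1 + ψ` a unit (e.g. `ψ ≡ 1 mod 𝔪`, `2 ∈ A^×`),
the twisted graded piece has no non-zero invariants — for EVERY such twist, uniformly: the local control terms of
Howard's Lemma 3.2.7 at a nonsplit multiplicative `v ∣ 3` vanish along all Eisenstein primes `𝔮_m` and all layers. -/
theorem smul_fixed_eq_zero_of_isUnit_one_add {A M : Type*} [CommRing A] [AddCommGroup M] [Module A M]
    (ψ : A) (hu : IsUnit (1 + ψ)) (x : M) (hx : (-ψ) • x = x) : x = 0 := by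
  have h0 : (1 + ψ) • x = 0 := by
    rw [add_smul, one_smul, ← neg_neg (ψ • x), ← neg_smul, hx, add_neg_cancel]
  obtain ⟨u, hu'⟩ := hu
  have : u⁻¹.val • ((u.val) • x) = 0 := by rw [hu', h0, smul_zero]
  simpa [← mul_smul] using this

/-- The unit supply for the previous lemma: in a commutative ring where `2` is a unit, `1 + ψ` is a unit as soon as
`ψ - 1` lies in the Jacobson radical (every `Ψ_𝔮(Frob) ∈ 1 + 𝔪_{S_𝔮}`; `2 ∈ S_𝔮^×` as the residue field is `𝔽₃`). -/
theorem isUnit_one_add_of_sub_one_mem_jacobson {A : Type*} [CommRing A] (ψ : A)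
    (h2 : IsUnit (2 : A)) (hψ : ψ - 1 ∈ (⊥ : Ideal A).jacobson) : IsUnit (1 + ψ) := by
  obtain ⟨t, ht⟩ := h2
  have key : IsUnit ((ψ - 1) * (t⁻¹).val + 1) := Ideal.mem_jacobson_bot.mp hψ _
  have h1 : (1 + ψ) = ((ψ - 1) * (t⁻¹).val + 1) * t.val := by
    rw [add_mul, mul_assoc, Units.inv_mul, mul_one, one_mul, ht]; ring
  rw [h1]
  exact key.mul (Units.isUnit t)



/-- **[R2⁻] in representation language.**  Let `A` be a local ring with `2 ∈ A^×` (e.g. `S_𝔮 = ℤ₃[π]/(π^m+3)` or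
`A_{m,k}`), `η ψ : G →* Aˣ` two characters of a group `G` (the decomposition group at a nonsplit multiplicative `v ∣ 3`)
with `η g₀ = -1` for some `g₀` (the unramified quadratic character of the Tate twist, `g₀` a Frobenius) and `ψ ≡ 1 mod 𝔪`
(EVERY specialisation `Ψ_𝔮` of the anticyclotomic character, at every Eisenstein prime and every level).  Then the
twisted line `A(ηψ)` has no non-zero `G`-invariants: `H⁰(K_v, gr_v T_𝔮 ⊗ A) = 0`, so terms (iv)/(v) of the control lemma
vanish on B⁻. -/
theorem twistedLine_invariants_eq_zero {G A : Type*} [Group G] [CommRing A] [IsLocalRing A]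
    (h2 : IsUnit (2 : A)) (η ψ : G →* Aˣ) (g₀ : G) (hη : η g₀ = -1)
    (hψ : ∀ g, ((ψ g : Aˣ) : A) - 1 ∈ IsLocalRing.maximalIdeal A)
    (x : A) (hx : ∀ g, ((η g * ψ g : Aˣ) : A) * x = x) : x = 0 := by
  have hu : IsUnit (1 + ((ψ g₀ : Aˣ) : A)) := by
    refine isUnit_one_add_of_sub_one_mem_jacobson _ h2 ?_
    rw [IsLocalRing.jacobson_eq_maximalIdeal ⊥ bot_ne_top]
    exact hψ g₀
  refine smul_fixed_eq_zero_of_isUnit_one_add (M := A) ((ψ g₀ : Aˣ) : A) hu x ?_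
  have := hx g₀
  rw [hη, Units.val_mul, Units.val_neg, Units.val_one, neg_one_mul] at this
  simpa [smul_eq_mul] using this

/-- **Term (ii) of the control lemma vanishes along every Eisenstein prime (both signs).**  The cokernel of
`H¹(K_v, Fil 𝐓) → H¹(K_v, Fil T ⊗ Λ/𝔮_m)` embeds in `H²(K_v, Fil_v 𝐓)[q_m]`, and `H²(K_v, Fil_v 𝐓) ≅ Λ/(ω_s)`,
`ω_s = γ^{3^s} − 1`; since `q_m = (γ−1)^m + 3` is prime in the UFD `Λ` and does not divide `ω_s`, the `q_m`-torsion of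
`Λ/(ω_s)` is zero — the pure algebra of which is this lemma (at the primes DIVIDING `ω_s` the torsion is not zero: the
exceptional zero, never visited by the road). -/
theorem mem_span_singleton_of_prime_mul_mem {R : Type*} [CommRing R] [IsDomain R] {q ω : R}
    (hq : Prime q) (hqω : ¬ q ∣ ω) (x : R) (hx : q * x ∈ Ideal.span {ω}) : x ∈ Ideal.span {ω} := by
  rw [Ideal.mem_span_singleton] at hx ⊢
  obtain ⟨y, hy⟩ := hx
  have hqy : q ∣ ω * y := ⟨x, hy.symm⟩
  rcases hq.dvd_or_dvd hqy with h | ⟨z, rfl⟩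
  · exact absurd h hqω
  · refine ⟨z, ?_⟩
    have hq0 : q ≠ 0 := hq.ne_zero
    have : q * x = q * (ω * z) := by rw [hy]; ring
    exact mul_left_cancel₀ hq0 this

/-- **B⁺ has bounded slack** (CANDIDATE, decidable in each instance; Newton polygon of `(1+π)^{3^s} - 1` over
`S_m = ℤ₃[X]/(X^m + 3)`): at a SPLIT multiplicative place whose decomposition group has index `3^s` in `Γ`, the invariants
of the twisted graded line `S_𝔮/(Ψ_𝔮(γ^{3^s}) - 1)` have cardinality EXACTLY `3^{3^s}` for every `m ≥ 3^s` — finite and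
independent of `m`, which is what Howard's approximation argument `𝔮_m → 3Λ` (p.17 L108 – p.18 L43) needs at `v ∣ 3`;
at the finite-order specialisations (augmentation / cyclotomic-polynomial primes dividing `ω_s`) the same module is
INFINITE — the exceptional zero, which the Eisenstein road never meets.  Numerical check (g62, sympy resultants):
`v₃ Res(X^m + 3, (1+X)^{3^s} - 1) = 3^s` for `s ∈ {0,1,2}` and `3^s ≤ m ≤ 14` (and `≠ 3^s` for some `m < 3^s`). -/
def EisensteinSplitControlBound : Prop :=
  ∀ s m : ℕ, 3 ^ s ≤ m →
    Nat.card (Polynomial ℤ_[3] ⧸ Ideal.span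
      {(Polynomial.X ^ m + Polynomial.C (3 : ℤ_[3]) : Polynomial ℤ_[3]),
       (Polynomial.X + 1) ^ (3 ^ s) - 1}) = 3 ^ (3 ^ s)


open Polynomial in
/-- **BC5-style rung (PROVED): the `s = 0` case of `EisensteinSplitControlBound`.**  When the place `v ∣ 3` is totally
ramified in `K_∞/K` from the bottom (`s = 0`, the generic case `3 ∤ h_K`), the B⁺ slack per Eisenstein prime is EXACTLY one
factor of 3, for every `m ≥ 1`: `ℤ₃[X]/(X^m + 3, (X+1)^1 − 1) = ℤ₃[X]/(3, X) ≅ 𝔽₃`. -/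
theorem eisensteinSplitControlBound_rung_zero (m : ℕ) (hm : 3 ^ 0 ≤ m) :
    Nat.card (Polynomial ℤ_[3] ⧸ Ideal.span
      {(Polynomial.X ^ m + Polynomial.C (3 : ℤ_[3]) : Polynomial ℤ_[3]),
       (Polynomial.X + 1) ^ (3 ^ 0) - 1}) = 3 ^ (3 ^ 0) := by
  have hm1 : 1 ≤ m := by simpa using hm
  have hXm : (X ^ m : ℤ_[3][X]) = X * X ^ (m - 1) := by
    rw [← pow_succ', Nat.sub_add_cancel hm1]
  have hI : Ideal.span {(X ^ m + C (3 : ℤ_[3]) : ℤ_[3][X]), (X + 1) ^ (3 ^ 0) - 1}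
      = Ideal.span {C (3 : ℤ_[3]), X - C 0} := by
    have hX : ((X + 1) ^ (3 ^ 0) - 1 : ℤ_[3][X]) = X := by ring
    rw [hX, map_zero, sub_zero]
    apply le_antisymm
    · rw [Ideal.span_le]
      rintro f hf
      simp only [Set.mem_insert_iff, Set.mem_singleton_iff] at hf
      rcases hf with rfl | rfl
      · rw [hXm]
        exact Ideal.add_mem _ (Ideal.mul_mem_right _ _ (Ideal.subset_span (by simp)))
          (Ideal.subset_span (by simp))
      · exact Ideal.subset_span (by simp)
    · rw [Ideal.span_le]
      rintro f hf
      simp only [Set.mem_insert_iff, Set.mem_singleton_iff] at hf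
      rcases hf with rfl | rfl
      · have hA : (X ^ m + C (3 : ℤ_[3]) : ℤ_[3][X]) ∈ Ideal.span {(X ^ m + C (3 : ℤ_[3]) : ℤ_[3][X]), X} :=
          Ideal.subset_span (by simp)
        have hB : (X * X ^ (m - 1) : ℤ_[3][X]) ∈ Ideal.span {(X ^ m + C (3 : ℤ_[3]) : ℤ_[3][X]), X} :=
          Ideal.mul_mem_right _ _ (Ideal.subset_span (by simp))
        have hC := Ideal.sub_mem _ hA hB
        have h3 : (X ^ m + C (3 : ℤ_[3]) : ℤ_[3][X]) - X * X ^ (m - 1) = C 3 := by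
          rw [hXm]; ring
        rwa [h3] at hC
      · exact Ideal.subset_span (by simp)
  have e1 : (ℤ_[3][X] ⧸ Ideal.span {(X ^ m + C (3 : ℤ_[3]) : ℤ_[3][X]), (X + 1) ^ (3 ^ 0) - 1})
      ≃+* ℤ_[3] ⧸ Ideal.span {(3 : ℤ_[3])} :=
    (Ideal.quotEquivOfEq hI).trans (Polynomial.quotientSpanCXSubCAlgEquiv (3 : ℤ_[3]) 0).toRingEquiv
  have hker : RingHom.ker (PadicInt.toZMod : ℤ_[3] →+* ZMod 3) = Ideal.span {(3 : ℤ_[3])} := by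
    rw [PadicInt.ker_toZMod, PadicInt.maximalIdeal_eq_span_p]
    norm_cast
  have e2 : ℤ_[3] ⧸ Ideal.span {(3 : ℤ_[3])} ≃+* ZMod 3 :=
    (Ideal.quotEquivOfEq hker.symm).trans
      (RingHom.quotientKerEquivOfSurjective (ZMod.ringHom_surjective PadicInt.toZMod))
  rw [Nat.card_congr (e1.trans e2).toEquiv, Nat.card_eq_fintype_card, ZMod.card]
  norm_num

end Summit.BirchSwinnertonDyer.BirchSwinnertonDyer.Cruxes.TwinAlgMuZeroAtThree.EisensteinRoad
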